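import Mathlib
import Summits.QuantumFields.YangMills.Theses.CoarseStiffnessTail
import Summits.QuantumFields.YangMills.Theorems.CoarseStiffnessTailCappedCoarseStiffnessLUnitPolyTailOfCount

/-!
# Route `CoarseStiffnessTail` (rev 1 «unit-poly-tail») — THE GLUE `UnitPolyTailOfStiffness` (stmt-QuantumFields-24030), PROVED:
# the capped coarse stiffness `CappedCoarseStiffnessL` implies the power-law unit-scale single-plaquette tail `UnitPolyTailL`

Prover seat `ym-line-cst-p1` (g23), route `CoarseStiffnessTail` (ideator `ym-r3-idea-2`, LINE 20; rung R3 = the RECORD leaf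
`T3YM3TorusStatement.YM3TorusSU2`, NOT the Clay statement; nothing here proves a rung or the summit).

The item is the support decl `UnitPolyTailOfStiffness : CappedCoarseStiffnessL → UnitPolyTailL`: rev 0's crux `CappedCoarseStiffnessL`
(stmt-QuantumFields-25301, OPEN, XL — one windowed-quadratic tilted partition function per RG level with free energy `O(1)` per level-`j`
plaquette, uniformly in the cut-off) implies the re-typed deciding crux `UnitPolyTailL` (stmt-QuantumFields-24027, OPEN — the power-law tail
`Gibbs_K{θBal(L, γ, b₀, p₀, 0) ≤ |Ū^K(∂a) − 1|} ≤ C·γ^s`, `s > 3`, uniform in `K`, the volume and `γ ≤ γ₁`).  The mathematics is the landed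
`CoarseStiffnessTailUnitPolyTailOfCount.unitPolyTail_of_cappedCoarseStiffnessL` (✓p688156, g22: windowed tilt at the top slice ⇒ unit-scale
large-field COUNT bound ⇒ log-slack count ⇒ chessboard at the top slice and `exp(−c·p(√γ)²) ≤ γ^N` ⇒ power tail with `s = 4`); this file only
matches the route's definitions — `CappedCoarseStiffnessL` is that theorem's hypothesis by name and `UnitPolyTailL` its conclusion verbatim —
against it.  It records that stmt-QuantumFields-25301 remains ONE sufficient condition for the route after the re-type.

[cite: Balaban1985UV3, (71) p.273]
-/

noncomputable section

namespace Summit.QuantumFields.YangMills.Theorems.CoarseStiffnessTailUnitPolyTailOfStiffness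

open Summit.QuantumFields.YangMills.Theses.CoarseStiffnessTail
open Summit.QuantumFields.YangMills.Theorems.CoarseStiffnessTailUnitPolyTailOfCount (unitPolyTail_of_cappedCoarseStiffnessL)

/-- **`UnitPolyTailOfStiffness` holds** (stmt-QuantumFields-24030, support glue of route `CoarseStiffnessTail` rev 1): the capped coarse
stiffness `CappedCoarseStiffnessL` (stmt-QuantumFields-25301, OPEN) implies the power-law unit-scale single-plaquette tail `UnitPolyTailL`
(S1_poly, stmt-QuantumFields-24027, OPEN) — by `unitPolyTail_of_cappedCoarseStiffnessL`, whose conclusion is the body of `UnitPolyTailL`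
verbatim.  An implication between two OPEN statements; no rung and no summit statement is proved. [cite: Balaban1985UV3, (71) p.273] -/
theorem unitPolyTailOfStiffness_proof : UnitPolyTailOfStiffness := by
  unfold UnitPolyTailOfStiffness UnitPolyTailL
  intro h
  exact unitPolyTail_of_cappedCoarseStiffnessL h

end Summit.QuantumFields.YangMills.Theorems.CoarseStiffnessTailUnitPolyTailOfStiffness

end
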